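import Literature.MathematicalPhysics.QuantumFieldTheory.Balaban1983to89.B11Prop5Model
import Literature.MathematicalPhysics.QuantumFieldTheory.Balaban1983to89.B11Eq142LocalMin
import Literature.MathematicalPhysics.QuantumFieldTheory.Balaban1983to89.B8SectDSource

/-!
# `Balaban1983to89.B11Prop7Model` — T. Bałaban, *The variational problem and background fields in renormalization group method
# for lattice gauge theories*, Commun. Math. Phys. **102** (1985) 277–309 [Balaban1985Variational], **Proposition 7** (p. 299):
# its CONTENT proved in the one-norm linearized chart model — (i) «at most one critical orbit» by the printed route Prop. 5 (critical
# ⇒ solution of (111)) + Prop. 6 (uniqueness of the solution by the contraction estimate (119)–(121)), (ii) «there exists a minimal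
# orbit … with ε₀ = O(1)C₁B₃ε₁» by the printed route (116)–(118) fixed point ⇒ (112) critical configuration ⇒ (141)–(142) minimum —
# and the typed statement of record `B11.Prop7Printed B₃ C₁ fam` INHABITED for the model family (kind «model-instance»)

statement-level skeleton of published theorems with citation tags; proofs where landed; nothing here is a claim about the Yang–Mills mass gap

PDF held: `paper:balaban1985-cmp102-variational-background` (journal page = PDF page + 276); pp. 294–299 [PDF 18–23] read from the held text
by this seat (2026-08-21; the OCR of the displays is poor — the verbatim Sect. E text (116)–(121) is the render-checked quotation in the
header of `B11Prop6Scheme`, pp. 296/299 were read as images by this seat for `B11Prop7Assembly`).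

CITATION HEADER (lean-in-tree rule 2026-08-18).  WHAT IS REPRODUCED: SKELETON row `B11.Prop7` (reader r08 `ROWS-B11.md`; decl of record
`B11.Prop7Printed B₃ C₁ fam`, B11.lean, typed-existing over the Theorem-1 carrier `B11.VarProblemX`; ASSEMBLED from Props 2, 5, 6 by name
modulo located leaves in `B11Prop7Assembly` (p255102)).  THE PRINT, p. 299 [PDF 23], verbatim: *"Proposition 7. There exist positive,
absolute constants a₀, a′₁ such that for ε₀ ≦ a₀ and B₃ε₁ ≦ ε₀ the variational problem (5), (6) has at most one critical orbit. If
ε₁ ≦ a′₁, then there exists a minimal orbit in the space (6) with ε₀ = O(1)C₁B₃ε₁."*  THE PRINTED PROOF.  Clause (i), p. 296 [PDF 20]: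
*"If we take ε₄ = 8ε₂, and if we assume 8ε₂ ≦ a₄ and 2B₀C₁B₃ε₁ ≦ 8ε₂, then by Propositions 5 and 6 there is at most one critical
configuration of (5) in (19)–(21). … (122) thus if B₃ε₁ ≦ ε₀ and 16B₁C₁ε₀ ≦ a₄, then the functional (5) has at most one critical orbit
in the space (6)."* — Prop. 5 p. 294: *"All critical configurations U₁ … can be obtained from solutions of Eq. (111) in the space (104) by
the transformation U₁ = exp iη[A₁ + H₁B − HD(A₁ + H₁B)]. (112)"*; Prop. 6 p. 295: *"Eq. (111) has exactly one solution in the space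
(115)"*, proved by *"A solution of Eq. (111) is a fixed point of the transformation A₁ → −𝔊J − 𝔊((δ/δA′)V)(A₁ + H₁B). (116) … By Theorem
3.13 of [5] the norm … of the transformation can be estimated by B₀|J|_{(−3)} + B₀|((δ/δA′)V)(A₁ + H₁B)|_{(−3)} < B₀C₁B₃ε₁ + B₀C₄(ε₄ +
B₀|B|)², (117) … the transformation (116) transforms the space (115) into itself if ε₄ + 2dLB₀C₁ε₁ ≦ a₃, B₀C₁B₃ε₁ + B₀C₄(ε₄ +
2dLB₀C₁ε₁)² ≦ ε₄. (118) … The norm … of this expression can be estimated by … = 4B₀C₄(ε₄ + B₀|B|)max{|A₁ − A₂|_{(−1)}, |∇(A₁ −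
A₂)|_{(−2)}}, (120) … We have to assume also that 2(ε₄ + B₀|B|) ≦ a₃, in order to be able to apply Proposition 4. Thus the transformation is
contractive if 2ε₄ + 4dLB₀C₁ε₁ ≦ a₃, 4B₀C₄(ε₄ + 2dLB₀C₁ε₁) ≦ ½. (121)"*.  Clause (ii), p. 296: *"Equation (111) has a solution belonging
to the space (115) with ε₄ = 2B₀C₁B₃ε₁, if 2B₀C₁B₃ε₁ ≦ a₄. This solution determines a critical configuration U₁ by the transformation
(112)"*, p. 299: *"Thus the expansion (81) for this functional has the form 𝔉(A′) = A(U_k) + ½⟨A′, Δ₁A′⟩ + V(A′). (142) A second order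
differential at A′ = 0 is given by the quadratic form above, and it is positive definite. Hence A′ = 0 is a minimum of the functional … and
this implies that U_k is a minimal configuration of the functional A(U)."*

WHAT IS CERTIFIED (kernel, sorry-free; axioms `propext` / `Classical.choice` / `Quot.sound`).
§1 The scheme (116)–(121) over a REAL normed space (the complex version with (120) DERIVED from analyticity by the Cauchy formula (119) is
   `B11Prop6Scheme.lipschitz_120`; here (98) and the Lipschitz form (120) of (δ/δA′)V are the inputs): `mapT116`, `eq111_iff_fixed`,
   `mapsTo_118`, `lipschitz_120`, `eq_of_fixed` (uniqueness from (120)–(121) alone), `existsUnique_fixed` (Banach on the closed ball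
   ‖A₁‖ ≤ ε₄, `B8SectDSource.fixedPoint_closedBall`).
§2 The model (`ChartDatum`, `ChartDatum.toVarProblemX`): per index a datum of real Hilbert spaces E (the chart variables A′ of (74)–(77) —
   the LINEARIZED COORDINATES reading (M1) of `B11Prop5Model`), F, S, boundary data `Bdry`; for each V the Sect. D operators
   `B11Prop5Model.SectDOps` at the background U₀ = U₀(V) of Sect. A with their structural inputs `SectDOps.Hyps` ([5] Thms 3.12–3.13), the
   block datum b(V) of (20)/(75), the functional V of (80)–(81) with gradient W = (δ/δA′)V, and the analytic INPUTS as fields: (117) «By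
   Theorem 3.13 of [5]» ‖𝔊f‖ ≤ B₀‖f‖ (𝔊 = G₁𝔓*); Prop. 4 (98) ‖W(A′)‖ ≤ C₄‖A′‖² on ‖A′‖ < a₃; (120) W is 4C₄m-Lipschitz on ‖A′‖ < m for
   2m ≤ a₃; Δ₁ symmetric and «positive definite» on the tangent space (83) in the coercive form γ‖δA′‖² ≤ ⟨δA′, Δ₁δA′⟩ ((142); [5] Thm 3.11);
   dL ≤ B₃ ((162)).  The Theorem-1 carrier: `Cfg := E`, `InU e A′ := ‖A′‖ < e` ((6)/(19) in the chart), `InB V A′ := QA′ = b(V) ∧ RD*A′ = 0`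
   ((75)–(76)), `IsCritical V A′ :=` (82) for the derivative (84), `SameOrbit := Eq` (the chart is a gauge slice: (16)–(18), Prop. 2),
   `Reg7 ε₁ V := ‖J‖ ≤ C₁B₃ε₁ ∧ ‖H₁b‖ < 2dLB₀C₁ε₁` ((7) read as its two consequences (28), (103) that Sects. D–E use),
   `OnMinimalOrbit e V A′ := ‖A′‖ < e ∧ A′ ∈ K_V ∧ IsLocalMinOn 𝔉_V K_V A′` (the LOCAL reading of p. 299, DIVERGENCE D-B11-2),
   `UniqueCriticalOrbit` literal; Sect. F/G regularity fields inert.  `laws`: the dictionary `B11.VarProblemX.Laws` HOLDS for the model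
   (minimal ⇒ critical = `crit_of_isLocalMinOn`, the calculus step print takes for granted on p. 300).
§3 Prop. 5 ⇔ (116) for the model: `crit_iff_fixed` (A′ ∈ K_V is (82)-critical iff A′ − H₁b is a fixed point of (116);
   `B11Prop5Model.critical82_iff_eq111` + `eq111_iff_fixed`), `T116_mem_T83` («Q𝔊 = 0, RD*𝔊 = 0»), `crit_of_isLocalMinOn` /
   `crit_of_onMinimal` (minimal ⇒ critical), `laws`.
§4 CLAUSE (i): **`eq_of_crit`** — for ε₀ ≤ a₀ := min{a₃/2, (8B₀C₄)⁻¹}/(1 + 4B₀C₁) (`a0`, `conds_of_le_a0`) and B₃ε₁ ≤ ε₀, two critical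
   A′, A″ ∈ 𝔘(ε₀) ∩ K_V are EQUAL: their translates solve (111) in the ball ‖A₁‖ ≤ ε₀ + 2dLB₀C₁ε₁ on which (116) is a strict contraction
   by (120)–(121), the hypothesis «B₃ε₁ ≦ ε₀» bounding the (103)-radius by 2B₀C₁ε₀ exactly as in (122).  Typed form `atMostOne_model`.
§5 CLAUSE (ii): **`exists_critical_minOn`** — for ε₁ ≤ a′₁ := a₄′/(2B₀C₁B₃), a₄′ := min{a₃/4, (16B₀C₄)⁻¹, γ/(32C₄)} (`a4'`, `a1'`: Prop. 6's
   a₄ = min{a₃/4, (16B₀C₄)⁻¹} and one more member for the minimality step): the fixed point A₁ of (116) in ‖A₁‖ ≤ ε₄ = 2B₀C₁B₃ε₁ exists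
   ((118), (121) at this ε₄: `conds_118_121`), A⋆ := A₁ + H₁b lies in K_V ∩ 𝔘(4B₀C₁B₃ε₁) and is (82)-critical ((112)), and A⋆ is THE STRICT
   GLOBAL MINIMUM of 𝔉_V on the space (6) ∩ K_V with ε₀ = 4B₀C₁B₃ε₁ (`B11Eq142LocalMin.isMinOn_of_critical` / `lt_of_critical_of_ne` with gap
   γ > 2θ, θ = 16C₄B₀C₁B₃ε₁ the (120)-Lipschitz constant on that ball, `norm_innerSL_gradV_sub_le`), hence on a minimal orbit in the typed
   (local) sense (`isLocalMinOn_of_isMinOn_inter_ball`); O(1) = 4B₀.  Typed forms `existsMinimal_model`, `uniqueCriticalOrbit_model` (the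
   Theorem-1 sentence «This orbit is a unique critical orbit in the space (6) if B₃ε₁ ≦ ε₀ and ε₀ ≦ a₀» for 4B₀C₁B₃ε₁ ≤ ε₀).
§6 **`prop7Printed_model : B11.Prop7Printed B₃ C₁ (fun i => (δ i).toVarProblemX C₁)`** for EVERY family of chart data with the printed
   constants fixed before the index (a₀, a′₁, O(1) = 4B₀ as above — functions of B₀, C₄, a₃, γ, B₃, C₁ alone); `laws_model`.

MODEL / DECLARED READINGS.  (M1)–(M4) of `B11Prop5Model` verbatim (linearized coordinates; (82) criticality; Sect. D inputs as `Hyps`; (111)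
literally with 𝔊 = G₁𝔓*).  (M7-a) NO GAUGE ORBITS IN THE CHART: by Prop. 2 / [6] Thm 2 and (16)–(18) every orbit of (6) meets the gauge-fixed
space in one configuration, so «lie on one orbit» is read as equality of chart points and Prop. 2's factor B₁ does not occur (the model's a₀
has the shape a₄/(const·C₁) of (122) with 1 + 4B₀C₁ for 16B₁C₁).  (M7-b) (7) ⇒ (14) ⇒ (28), (103): `Reg7` is read as the two consequences
of (7) used by the proof (as `B11Prop6Model`'s `Sat14`).  (M7-c) V is C¹ on E with gradient W (print: analytic on (77), Prop. 4); the
quantitative hypotheses (98), (120) are assumed only on the printed balls; (120) is an INPUT here (in print derived from (98) + analyticity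
by (119), kernel-checked over ℂ in `B11Prop6Scheme.lipschitz_120`).  (M7-d) «positive definite» (p. 299, [5] Thm 3.11) in the coercive form
with ONE γ > 0 for the family, in the model norm (on finite-dimensional T pointwise positivity gives a γ per background,
`B11Eq142LocalMin.coercive_of_posDef`; uniformity is a hypothesis).  (M7-e) «minimal orbit» = local minimum on the constraint space K_V (the
reading under which `B11.VarProblemX.Laws` (iii) is valid for all e, e′, B11.lean); the GLOBAL minimum on the space (6) with
ε₀ = 4B₀C₁B₃ε₁ is proved in addition (§5) — in the one-norm model, NOT for the lattice norms ((ML)/GAPS G-B11-E5g of `B11GlobalMin`).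
HONEST SCOPE.  Nothing of the lattice is constructed: 𝔊, H₁, (δ/δA′)V, J, Δ₁ on Bałaban's lattice and their bounds ([5] Thms 3.11–3.13,
Prop. 4, (28), (103)) are hypotheses carried by the datum (INTERFACES §3 NE9 letters, socket C19′ — frozen); Prop. 2 ([6] Thm 2) and
Prop. 3's change of variables are absorbed in reading (M1)/(M7-a) and NOT re-proved; «absolute constants» = (d, L)-dependent through B₀, C₄,
a₃, γ (DIVERGENCE D-B11-3).  Mega-formalization `lit-balaban`, HOME `run/shared/lean/pub/lit-balaban/`, reader/typer seat r08 gen 7 (unit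
`lit-balaban-r08`).  Imports `B11Prop5Model`, `B11Eq142LocalMin`, `B8SectDSource`; modifies nothing.  Net new unproved facts: 0.
-/

noncomputable section

open scoped InnerProductSpace
open Set Metric Filter Topology

namespace Literature.MathematicalPhysics.QuantumFieldTheory.Balaban1983to89.B11Prop7Model

open B11Eq127EulerLagrange (functional81)
open B11Eq81Expansion (IsCritical82 tangent83 mem_tangent83_iff isCritical82_iff)
open B11Prop5Model (SectDOps critical82_iff_eq111)
open B11Eq142LocalMin (isMinOn_of_critical lt_of_critical_of_ne)
open B8SectDSource (fixedPoint_closedBall)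

/-! ## §1 The scheme (116)–(121) over a real normed space -/

section Scheme

variable {E : Type*} [NormedAddCommGroup E] [NormedSpace ℝ E]

/-- **(116)** p. 295: *"A solution of Eq. (111) is a fixed point of the transformation A₁ → −𝔊J − 𝔊((δ/δA′)V)(A₁ + H₁B). (116)"* — the map
`X ↦ −𝔊J − 𝔊(W(X + 𝔄))` for a real-linear 𝔊, a map W (= (δ/δA′)V), a current J and a configuration 𝔄 (= H₁B).
[cite: Balaban1985Variational, (116) p.295] -/
def mapT116 (𝔊 : E →ₗ[ℝ] E) (W : E → E) (J 𝔄 : E) (X : E) : E :=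
  -𝔊 J - 𝔊 (W (X + 𝔄))

/-- **(111) ⟺ fixed point of (116)**: `X + 𝔊J + 𝔊(W(X + 𝔄)) = 0 ↔ mapT116 𝔊 W J 𝔄 X = X`. [cite: Balaban1985Variational, (111) p.294, (116) p.295] -/
theorem eq111_iff_fixed (𝔊 : E →ₗ[ℝ] E) (W : E → E) (J 𝔄 X : E) :
    X + 𝔊 J + 𝔊 (W (X + 𝔄)) = 0 ↔ mapT116 𝔊 W J 𝔄 X = X := by
  unfold mapT116
  generalize 𝔊 (W (X + 𝔄)) = K
  constructor
  · intro h
    have h' : X = -𝔊 J - K := by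
      rw [← sub_eq_zero, ← h]; abel
    rw [h']
  · intro h
    rw [← h]; abel

/-- The value of (116) lies in the range of 𝔊: `mapT116 𝔊 W J 𝔄 X = 𝔊(−J − W(X + 𝔄))`. [cite: Balaban1985Variational, (116) p.295] -/
theorem mapT116_eq_apply (𝔊 : E →ₗ[ℝ] E) (W : E → E) (J 𝔄 X : E) :
    mapT116 𝔊 W J 𝔄 X = 𝔊 (-J - W (X + 𝔄)) := by
  simp only [mapT116, map_sub, map_neg]

variable {𝔊 : E →ₗ[ℝ] E} {W : E → E} {B₀ C₄ a₃ : ℝ}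

/-- **(117)–(118): the transformation maps the ball ‖A₁‖ ≤ ε₄ into itself** (p. 295 (117) «B₀|J|_{(−3)} + B₀|((δ/δA′)V)(A₁ + H₁B)|_{(−3)} <
B₀C₁B₃ε₁ + B₀C₄(ε₄ + B₀|B|)², if ε₄ + B₀|B| ≦ a₃» and (118)): with ‖𝔊f‖ ≤ B₀‖f‖, (98) ‖W(z)‖ ≤ C₄‖z‖² on ‖z‖ < a₃, ‖J‖ ≤ j, ‖𝔄‖ < a,
ρ + a ≤ a₃ and B₀j + B₀C₄(ρ + a)² ≤ ρ: ‖X‖ ≤ ρ ⟹ ‖mapT116 X‖ ≤ ρ. [cite: Balaban1985Variational, (117)–(118) p.295] -/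
theorem mapsTo_118 (h𝔊 : ∀ f, ‖𝔊 f‖ ≤ B₀ * ‖f‖) (hB₀ : 0 ≤ B₀) (hC₄ : 0 ≤ C₄)
    (hquad : ∀ z : E, ‖z‖ < a₃ → ‖W z‖ ≤ C₄ * ‖z‖ ^ 2)
    {J 𝔄 : E} {j a ρ : ℝ} (hJ : ‖J‖ ≤ j) (h𝔄 : ‖𝔄‖ < a) (hdom : ρ + a ≤ a₃)
    (hself : B₀ * j + B₀ * C₄ * (ρ + a) ^ 2 ≤ ρ) :
    ∀ X : E, ‖X‖ ≤ ρ → ‖mapT116 𝔊 W J 𝔄 X‖ ≤ ρ := by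
  intro X hX
  have harg : ‖X + 𝔄‖ < ρ + a := (norm_add_le X 𝔄).trans_lt (by linarith)
  have h0 : 0 ≤ ‖X + 𝔄‖ := norm_nonneg _
  have hW : ‖W (X + 𝔄)‖ ≤ C₄ * ‖X + 𝔄‖ ^ 2 := hquad _ (harg.trans_le hdom)
  have hsq : ‖X + 𝔄‖ ^ 2 ≤ (ρ + a) ^ 2 := pow_le_pow_left₀ h0 harg.le 2
  have h1 : ‖𝔊 J‖ ≤ B₀ * j := (h𝔊 J).trans (mul_le_mul_of_nonneg_left hJ hB₀)
  have h2 : ‖𝔊 (W (X + 𝔄))‖ ≤ B₀ * C₄ * (ρ + a) ^ 2 := by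
    calc ‖𝔊 (W (X + 𝔄))‖ ≤ B₀ * ‖W (X + 𝔄)‖ := h𝔊 _
      _ ≤ B₀ * (C₄ * (ρ + a) ^ 2) :=
          mul_le_mul_of_nonneg_left (hW.trans (mul_le_mul_of_nonneg_left hsq hC₄)) hB₀
      _ = B₀ * C₄ * (ρ + a) ^ 2 := by ring
  calc ‖mapT116 𝔊 W J 𝔄 X‖ = ‖-𝔊 J - 𝔊 (W (X + 𝔄))‖ := rfl
    _ ≤ ‖-𝔊 J‖ + ‖𝔊 (W (X + 𝔄))‖ := norm_sub_le _ _
    _ = ‖𝔊 J‖ + ‖𝔊 (W (X + 𝔄))‖ := by rw [norm_neg]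
    _ ≤ B₀ * j + B₀ * C₄ * (ρ + a) ^ 2 := add_le_add h1 h2
    _ ≤ ρ := hself

/-- **(119)–(120): the contraction estimate** (p. 295 (120) «= 4B₀C₄(ε₄ + B₀|B|)max{|A₁ − A₂|_{(−1)}, |∇(A₁ − A₂)|_{(−2)}}», «We have to assume
also that 2(ε₄ + B₀|B|) ≦ a₃»): with ‖𝔊f‖ ≤ B₀‖f‖ and W 4C₄m-Lipschitz on the ball ‖z‖ < m whenever 2m ≤ a₃ (the printed outcome of the
Cauchy-formula step (119), an INPUT here), ‖𝔄‖ < a and 2(ρ + a) ≤ a₃: on ‖X‖ ≤ ρ the map (116) is 4B₀C₄(ρ + a)-Lipschitz.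
[cite: Balaban1985Variational, (119)–(120) p.295] -/
theorem lipschitz_120 (h𝔊 : ∀ f, ‖𝔊 f‖ ≤ B₀ * ‖f‖) (hB₀ : 0 ≤ B₀)
    (hlip : ∀ m : ℝ, 2 * m ≤ a₃ → ∀ z z' : E, ‖z‖ < m → ‖z'‖ < m → ‖W z - W z'‖ ≤ 4 * C₄ * m * ‖z - z'‖)
    {J 𝔄 : E} {a ρ : ℝ} (h𝔄 : ‖𝔄‖ < a) (hdom : 2 * (ρ + a) ≤ a₃) {X₁ X₂ : E} (h₁ : ‖X₁‖ ≤ ρ)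
    (h₂ : ‖X₂‖ ≤ ρ) :
    ‖mapT116 𝔊 W J 𝔄 X₁ - mapT116 𝔊 W J 𝔄 X₂‖ ≤ 4 * B₀ * C₄ * (ρ + a) * ‖X₁ - X₂‖ := by
  have ha1 : ‖X₁ + 𝔄‖ < ρ + a := (norm_add_le _ _).trans_lt (by linarith)
  have ha2 : ‖X₂ + 𝔄‖ < ρ + a := (norm_add_le _ _).trans_lt (by linarith)
  have hW := hlip (ρ + a) hdom _ _ ha1 ha2
  have hsub : X₁ + 𝔄 - (X₂ + 𝔄) = X₁ - X₂ := by abel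
  rw [hsub] at hW
  have hdiff : mapT116 𝔊 W J 𝔄 X₁ - mapT116 𝔊 W J 𝔄 X₂ = -(𝔊 (W (X₁ + 𝔄) - W (X₂ + 𝔄))) := by
    simp only [mapT116, map_sub]; abel
  rw [hdiff, norm_neg]
  calc ‖𝔊 (W (X₁ + 𝔄) - W (X₂ + 𝔄))‖ ≤ B₀ * ‖W (X₁ + 𝔄) - W (X₂ + 𝔄)‖ := h𝔊 _
    _ ≤ B₀ * (4 * C₄ * (ρ + a) * ‖X₁ - X₂‖) := mul_le_mul_of_nonneg_left hW hB₀
    _ = 4 * B₀ * C₄ * (ρ + a) * ‖X₁ - X₂‖ := by ring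

/-- **Uniqueness from (120)–(121) alone** (Prop. 6 «exactly one solution in the space (115)», the part used by Prop. 7 (i)): two fixed
points of (116) in the ball ‖X‖ ≤ ρ coincide as soon as the Lipschitz constant 4B₀C₄(ρ + a) is < 1 (printed: ≦ ½, (121)); no self-map
condition is needed. [cite: Balaban1985Variational, (120)–(121) p.295, Prop. 6 p.295] -/
theorem eq_of_fixed (h𝔊 : ∀ f, ‖𝔊 f‖ ≤ B₀ * ‖f‖) (hB₀ : 0 ≤ B₀)
    (hlip : ∀ m : ℝ, 2 * m ≤ a₃ → ∀ z z' : E, ‖z‖ < m → ‖z'‖ < m → ‖W z - W z'‖ ≤ 4 * C₄ * m * ‖z - z'‖)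
    {J 𝔄 : E} {a ρ : ℝ} (h𝔄 : ‖𝔄‖ < a) (hdom : 2 * (ρ + a) ≤ a₃) (hcontr : 4 * B₀ * C₄ * (ρ + a) < 1)
    {X₁ X₂ : E} (h₁ : ‖X₁‖ ≤ ρ) (h₂ : ‖X₂‖ ≤ ρ) (hf₁ : mapT116 𝔊 W J 𝔄 X₁ = X₁)
    (hf₂ : mapT116 𝔊 W J 𝔄 X₂ = X₂) : X₁ = X₂ := by
  have h := lipschitz_120 (J := J) h𝔊 hB₀ hlip h𝔄 hdom h₁ h₂
  rw [hf₁, hf₂] at h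
  by_contra hne
  have hpos : 0 < ‖X₁ - X₂‖ := norm_pos_iff.2 (sub_ne_zero.2 hne)
  have : 0 < (1 - 4 * B₀ * C₄ * (ρ + a)) * ‖X₁ - X₂‖ := mul_pos (by linarith) hpos
  nlinarith

/-- **Exactly one fixed point in the ball ‖A₁‖ ≤ ε₄** — Prop. 6's scheme on a real Banach space: self-map (118) + contraction (120)–(121)
(`B8SectDSource.fixedPoint_closedBall`). [cite: Balaban1985Variational, Prop. 6 (116)–(121) p.295] -/
theorem existsUnique_fixed [CompleteSpace E] (h𝔊 : ∀ f, ‖𝔊 f‖ ≤ B₀ * ‖f‖) (hB₀ : 0 ≤ B₀) (hC₄ : 0 ≤ C₄)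
    (hquad : ∀ z : E, ‖z‖ < a₃ → ‖W z‖ ≤ C₄ * ‖z‖ ^ 2)
    (hlip : ∀ m : ℝ, 2 * m ≤ a₃ → ∀ z z' : E, ‖z‖ < m → ‖z'‖ < m → ‖W z - W z'‖ ≤ 4 * C₄ * m * ‖z - z'‖)
    {J 𝔄 : E} {j a ρ : ℝ} (hJ : ‖J‖ ≤ j) (h𝔄 : ‖𝔄‖ < a) (hρ : 0 ≤ ρ) (hdom : 2 * (ρ + a) ≤ a₃)
    (hself : B₀ * j + B₀ * C₄ * (ρ + a) ^ 2 ≤ ρ) (hcontr : 4 * B₀ * C₄ * (ρ + a) < 1) :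
    ∃! X : E, ‖X‖ ≤ ρ ∧ mapT116 𝔊 W J 𝔄 X = X := by
  have ha : 0 < a := (norm_nonneg _).trans_lt h𝔄
  have hdom1 : ρ + a ≤ a₃ := by linarith
  have hρa : 0 ≤ ρ + a := by linarith
  have hκ0 : 0 ≤ 4 * B₀ * C₄ * (ρ + a) := by positivity
  exact fixedPoint_closedBall (mapT116 𝔊 W J 𝔄) hρ hκ0 hcontr
    (mapsTo_118 h𝔊 hB₀ hC₄ hquad hJ h𝔄 hdom1 hself)
    (fun x y hx hy => lipschitz_120 (J := J) h𝔊 hB₀ hlip h𝔄 hdom hx hy)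

end Scheme

/-! ## §2 The chart datum and the Theorem-1 carrier it defines -/

/-- **A datum of the Prop. 7 model** over real Hilbert spaces `E` (chart variables A′ of (74)–(77); one norm for max{|·|_{(−1)}, |∇·|_{(−2)}}
and |·|_{(−3)}), `F`, `S` and boundary data `Bdry`, with the printed constants B₀ ((117), [5] Thm 3.13), C₄, a₃ (Prop. 4), γ («positive
definite», (142)), B₃ ((162)) fixed: scale data `L`, `dim` with dL ≤ B₃; for each boundary datum V — through the background U₀ = U₀(V) of
Sect. A (12)–(14) — the Sect. D operators `ops V` (Δ₁, G₁, 𝔓, 𝔓*, Q, Q*, (QG₁Q*)⁻¹, D, R, D*, a, J, W = (δ/δA′)V), the block datum `bdat V` = b of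
(20)/(75), the constant `act0 V` = A(U₀) and the functional `Vfun V` = V of (80)–(81); and the INPUTS as fields: `hyps` (Sect. D structure,
[5] Thms 3.12–3.13), `symm` (Δ₁ symmetric, (79)), `coercive` (γ‖δA′‖² ≤ ⟨δA′, Δ₁δA′⟩ on the tangent space (83)), `norm_G` ((117)), `hasGrad`
(W is the gradient of V, (84)), `quad98` ((98)), `lip120` ((120): W is 4C₄m-Lipschitz on ‖A′‖ < m for 2m ≤ a₃), `dL_le`.  A MODEL datum:
every analytic input is a hypothesis carried by the index; nothing of [5], of Prop. 4 or of the lattice is asserted.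
[cite: Balaban1985Variational, (74)–(84) pp.289–290, (98) p.293, (111) p.294, (116)–(120) p.295, (142) p.299] -/
structure ChartDatum (E F S Bdry : Type) [NormedAddCommGroup E] [InnerProductSpace ℝ E] [NormedAddCommGroup F]
    [InnerProductSpace ℝ F] [AddCommGroup S] [Module ℝ S] (B₀ C₄ a₃ γ B₃ : ℝ) where
  /-- the scale factor L -/
  L : ℝ
  /-- the dimension d -/
  dim : ℕ
  /-- the Sect. D operators at the background U₀(V) -/
  ops : Bdry → SectDOps E F S
  /-- the block datum b of (20)/(75), «uniquely determined by V» -/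
  bdat : Bdry → F
  /-- the constant A(U₀) of (81) -/
  act0 : Bdry → ℝ
  /-- the functional V of (80)–(81) -/
  Vfun : Bdry → E → ℝ
  /-- the structural inputs of Sect. D ([5] Thms 3.12–3.13) — an INPUT -/
  hyps : ∀ V, (ops V).Hyps
  /-- Δ₁ is symmetric ((79), [5]) — an INPUT -/
  symm : ∀ V (x y : E), ⟪(ops V).Δ₁ x, y⟫_ℝ = ⟪x, (ops V).Δ₁ y⟫_ℝ
  /-- «positive definite» on the tangent space (83), coercive form — an INPUT -/
  coercive : ∀ V, ∀ A ∈ tangent83 (ops V).Q (ops V).R (ops V).Dstar, γ * ‖A‖ ^ 2 ≤ ⟪A, (ops V).Δ₁ A⟫_ℝ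
  /-- (117): ‖𝔊f‖ ≤ B₀‖f‖, 𝔊 = G₁𝔓* — an INPUT -/
  norm_G : ∀ V (f : E), ‖((ops V).G₁ ∘ₗ (ops V).Padj) f‖ ≤ B₀ * ‖f‖
  /-- W = (δ/δA′)V is the gradient of V ((84)) -/
  hasGrad : ∀ V (A : E), HasFDerivAt (Vfun V) (innerSL ℝ ((ops V).gradV A)) A
  /-- Proposition 4 (98) — an INPUT -/
  quad98 : ∀ V (A : E), ‖A‖ < a₃ → ‖(ops V).gradV A‖ ≤ C₄ * ‖A‖ ^ 2
  /-- the Lipschitz estimate (120) of (δ/δA′)V — an INPUT -/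
  lip120 : ∀ V (m : ℝ), 2 * m ≤ a₃ → ∀ A A' : E, ‖A‖ < m → ‖A'‖ < m →
    ‖(ops V).gradV A - (ops V).gradV A'‖ ≤ 4 * C₄ * m * ‖A - A'‖
  L_nonneg : 0 ≤ L
  /-- dL ≤ B₃ (true for the B₃ of (162)) -/
  dL_le : (dim : ℝ) * L ≤ B₃

namespace ChartDatum

variable {E F S Bdry : Type} [NormedAddCommGroup E] [InnerProductSpace ℝ E] [NormedAddCommGroup F]
  [InnerProductSpace ℝ F] [AddCommGroup S] [Module ℝ S] {B₀ C₄ a₃ γ B₃ : ℝ}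
  (Dt : ChartDatum E F S Bdry B₀ C₄ a₃ γ B₃)

/-- **𝔉_V** = the functional (81) `A(U₀) + ⟨A′, J⟩ + ½⟨A′, Δ₁A′⟩ + V(A′)` of the datum at V (`B11Eq127EulerLagrange.functional81`).
[cite: Balaban1985Variational, (81) p.290] -/
def frakF (V : Bdry) : E → ℝ :=
  functional81 (Dt.act0 V) (Dt.ops V).J ((Dt.ops V).Δ₁ : E →ₗ[ℝ] E) (Dt.Vfun V)

/-- **K_V** = the constraint space (75)–(76) `{A′ : QA′ = b, RD*A′ = 0}` of the chart at V. [cite: Balaban1985Variational, (75)–(76) p.289] -/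
def Kset (V : Bdry) : Set E :=
  {A | (Dt.ops V).Q A = Dt.bdat V ∧ (Dt.ops V).R ((Dt.ops V).Dstar A) = 0}

/-- **The tangent space (83)** of the datum at V. [cite: Balaban1985Variational, (83) p.290] -/
abbrev T83 (V : Bdry) : Submodule ℝ E :=
  tangent83 (Dt.ops V).Q (Dt.ops V).R (Dt.ops V).Dstar

/-- **(82)**: A′ is a critical configuration — the derivative (84) `⟨·, J⟩ + ⟨·, Δ₁A′⟩ + ⟨·, W(A′)⟩` vanishes on the tangent space (83).
[cite: Balaban1985Variational, (82)–(84) p.290] -/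
def Crit (V : Bdry) (A : E) : Prop :=
  IsCritical82 (innerSL ℝ (Dt.ops V).J + innerSL ℝ ((Dt.ops V).Δ₁ A) + innerSL ℝ ((Dt.ops V).gradV A)) (Dt.T83 V)

/-- **The transformation (116) of the datum at V**: `A₁ ↦ −𝔊J − 𝔊W(A₁ + H₁b)`, 𝔊 = G₁𝔓*. [cite: Balaban1985Variational, (116) p.295] -/
def T116 (V : Bdry) : E → E :=
  mapT116 ((Dt.ops V).G₁ ∘ₗ (Dt.ops V).Padj) (Dt.ops V).gradV (Dt.ops V).J ((Dt.ops V).H₁ (Dt.bdat V))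

/-- **The Theorem-1 carrier `B11.VarProblemX` of a chart datum** (readings of the header): `Cfg := E`; `InU e A′ := ‖A′‖ < e`; `InB V A′ :=
A′ ∈ K_V`; `Reg7 ε₁ V := ‖J‖ ≤ C₁B₃ε₁ ∧ ‖H₁b‖ < 2dLB₀C₁ε₁` ((28), (103)); `IsCritical V A′ :=` (82); `SameOrbit := Eq`; `OnMinimalOrbit e V A′ :=
‖A′‖ < e ∧ A′ ∈ K_V ∧ IsLocalMinOn 𝔉_V K_V A′`; `UniqueCriticalOrbit ε₀ V A′ :=` A′ is critical in 𝔘(ε₀) ∩ K_V and every critical A″ there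
equals A′; the regularity fields of (9)–(10) inert. [cite: Balaban1985Variational, (2)–(7) p.278, (8) p.279, (75)–(76) p.289, (77) p.290, (82) p.290] -/
def toVarProblemX (C₁ : ℝ) : B11.VarProblemX where
  Cfg := E
  Bdry := Bdry
  Cube := PUnit
  scale := fun _ => 0
  sizeM := fun _ => 0
  eta := 1
  L := Dt.L
  InU := fun e A => ‖A‖ < e
  InB := fun V A => A ∈ Dt.Kset V
  Reg7 := fun ε₁ V => ‖(Dt.ops V).J‖ ≤ C₁ * B₃ * ε₁ ∧
    ‖(Dt.ops V).H₁ (Dt.bdat V)‖ < 2 * ((Dt.dim : ℝ) * Dt.L) * B₀ * C₁ * ε₁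
  OnMinimalOrbit := fun e V A => ‖A‖ < e ∧ A ∈ Dt.Kset V ∧ IsLocalMinOn (Dt.frakF V) (Dt.Kset V) A
  UniqueCriticalOrbit := fun ε₀ V A => ‖A‖ < ε₀ ∧ A ∈ Dt.Kset V ∧ Dt.Crit V A ∧
    ∀ A' : E, ‖A'‖ < ε₀ → A' ∈ Dt.Kset V → Dt.Crit V A' → A' = A
  Gauged := fun _ _ => True
  normA := fun _ _ => 0
  normGradA := fun _ _ => 0
  holderA := fun _ _ _ => 0
  normLapA := fun _ _ => 0
  IsCritical := fun V A => Dt.Crit V A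
  SameOrbit := fun A A' => A = A'

/-! ## §3 Elementary facts of the model: the constraint space, Prop. 5 ⇔ (116), minimal ⇒ critical, the laws -/

/-- Membership in K_V. [cite: Balaban1985Variational, (75)–(76) p.289] -/
theorem mem_Kset_iff (V : Bdry) (A : E) :
    A ∈ Dt.Kset V ↔ (Dt.ops V).Q A = Dt.bdat V ∧ (Dt.ops V).R ((Dt.ops V).Dstar A) = 0 :=
  Iff.rfl

/-- Differences of points of K_V lie in the tangent space (83). [cite: Balaban1985Variational, (83) p.290] -/
theorem sub_mem_T83 (V : Bdry) {A A' : E} (hA : A ∈ Dt.Kset V) (hA' : A' ∈ Dt.Kset V) : A - A' ∈ Dt.T83 V := by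
  rw [T83, mem_tangent83_iff]
  obtain ⟨h1, h2⟩ := hA
  obtain ⟨h1', h2'⟩ := hA'
  refine ⟨?_, ?_⟩
  · rw [map_sub, h1, h1', sub_self]
  · rw [map_sub, map_sub, h2, h2', sub_self]

/-- Lines in tangent directions stay in K_V: A′ ∈ K_V, δA′ ∈ (83) ⟹ A′ + tδA′ ∈ K_V. [cite: Balaban1985Variational, (83) p.290] -/
theorem add_smul_mem_Kset (V : Bdry) {A δ : E} (hA : A ∈ Dt.Kset V) (hδ : δ ∈ Dt.T83 V) (t : ℝ) :
    A + t • δ ∈ Dt.Kset V := by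
  obtain ⟨hQ, hR⟩ := (mem_tangent83_iff _ _ _ δ).1 hδ
  obtain ⟨h1, h2⟩ := hA
  refine ⟨?_, ?_⟩
  · rw [map_add, map_smul, hQ, smul_zero, add_zero, h1]
  · rw [map_add, map_smul, map_add, map_smul, hR, smul_zero, add_zero, h2]

/-- **«Q𝔊 = 0, RD*𝔊 = 0»** (p. 294): the value of (116) lies in the tangent space (83) (`B11Eq108Reduction.frakG_mem`).
[cite: Balaban1985Variational, (110)–(111) p.294, (116) p.295] -/
theorem T116_mem_T83 (V : Bdry) (X : E) : Dt.T116 V X ∈ Dt.T83 V := by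
  have hX := Dt.hyps V
  rw [T116, mapT116_eq_apply, T83, mem_tangent83_iff]
  exact B11Eq108Reduction.frakG_mem hX.MG hX.GM hX.PK hX.Psym hX.Padj_spec _

/-- **Proposition 5 in the model, in fixed-point form**: for A′ ∈ K_V, A′ is a critical configuration (82) IFF A₁ = A′ − H₁b is a fixed
point of (116) (`B11Prop5Model.critical82_iff_eq111` «(82) ⇔ (111)» + `eq111_iff_fixed`).
[cite: Balaban1985Variational, Prop. 5 (111)–(112) p.294, (116) p.295] -/
theorem crit_iff_fixed (V : Bdry) {A : E} (hA : A ∈ Dt.Kset V) :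
    Dt.Crit V A ↔ Dt.T116 V (A - (Dt.ops V).H₁ (Dt.bdat V)) = A - (Dt.ops V).H₁ (Dt.bdat V) := by
  have hX := Dt.hyps V
  obtain ⟨hQA, hRA⟩ := hA
  rw [Crit, T83, critical82_iff_eq111 hX.adj hX.MG hX.GM hX.PK hX.Pid hX.Psym hX.Padj_spec hX.Kinv_spec
    (hX.landau _) hQA hRA, T116, ← eq111_iff_fixed, sub_add_cancel]

/-- **Minimal ⇒ critical** (the calculus step print takes for granted, p. 300 «We will use only the fact that they are critical
configurations»): a local minimum of 𝔉 = (81) on a set K containing the tangent lines A′ + tδA′ (δA′ ∈ T) is (82)-critical on T, for Δ₁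
symmetric and V differentiable at A′ with gradient W (`B11Eq127EulerLagrange.eq127`). [cite: Balaban1985Variational, (82) p.290, (127) p.297] -/
theorem crit_of_isLocalMinOn {c : ℝ} {J : E} {Δ₁ : E →L[ℝ] E} (hΔ : ∀ x y, ⟪Δ₁ x, y⟫_ℝ = ⟪x, Δ₁ y⟫_ℝ)
    {Vf : E → ℝ} {W A : E} (hV : HasFDerivAt Vf (innerSL ℝ W) A) {K : Set E} {T : Submodule ℝ E}
    (hK : ∀ δ ∈ T, ∀ t : ℝ, A + t • δ ∈ K)
    (hmin : IsLocalMinOn (functional81 c J (Δ₁ : E →ₗ[ℝ] E) Vf) K A) :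
    IsCritical82 (innerSL ℝ J + innerSL ℝ (Δ₁ A) + innerSL ℝ W) T := by
  have hline : ∀ δ ∈ T, IsLocalMin (fun t : ℝ => functional81 c J (Δ₁ : E →ₗ[ℝ] E) Vf (A + t • δ)) 0 := by
    intro δ hδ
    have hg : Tendsto (fun t : ℝ => A + t • δ) (𝓝 0) (𝓝[K] A) := by
      refine tendsto_nhdsWithin_iff.2 ⟨?_, Eventually.of_forall fun t => hK δ hδ t⟩
      have hc : Continuous fun t : ℝ => A + t • δ := continuous_const.add (continuous_id.smul continuous_const)
      simpa using hc.tendsto 0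
    have h1 : ∀ᶠ t in 𝓝 (0 : ℝ), functional81 c J (Δ₁ : E →ₗ[ℝ] E) Vf A ≤
        functional81 c J (Δ₁ : E →ₗ[ℝ] E) Vf (A + t • δ) := hg.eventually hmin
    show ∀ᶠ t in 𝓝 (0 : ℝ), _ ≤ _
    simpa only [zero_smul, add_zero] using h1
  have h := B11Eq127EulerLagrange.eq127 (fun x y => hΔ x y) hV T hline
  rw [isCritical82_iff]
  simpa only [ContinuousLinearMap.coe_coe] using h

/-- In the model: a configuration on a minimal orbit is critical. [cite: Balaban1985Variational, p.299 (142), p.300] -/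
theorem crit_of_onMinimal (V : Bdry) {A : E} (hA : A ∈ Dt.Kset V) (hmin : IsLocalMinOn (Dt.frakF V) (Dt.Kset V) A) :
    Dt.Crit V A :=
  crit_of_isLocalMinOn (c := Dt.act0 V) (Dt.symm V) (Dt.hasGrad V A)
    (fun _ hδ t => Dt.add_smul_mem_Kset V hA hδ t) hmin

/-- **The dictionary `B11.VarProblemX.Laws` holds for the model**: (i) 𝔘(e) ⊂ 𝔘(e′) for e ≤ e′; (ii) minimal ⇒ critical ∧ in the space;
(iii) the local reading of «minimal orbit»; (iv) «unique critical orbit» literal. [cite: Balaban1985Variational, pp.299–305] -/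
theorem laws (C₁ : ℝ) : (Dt.toVarProblemX C₁).Laws := by
  unfold B11.VarProblemX.Laws
  dsimp only [toVarProblemX]
  refine ⟨?_, ?_, ?_, ?_⟩
  · intro e e' U hee' hU
    exact lt_of_lt_of_le hU hee'
  · intro e V U hmin
    exact ⟨Dt.crit_of_onMinimal V hmin.2.1 hmin.2.2, hmin.1, hmin.2.1⟩
  · intro e e' V U hmin hU
    exact ⟨hU, hmin.2.1, hmin.2.2⟩
  · intro ε₀ V U hU hB hc huniq
    exact ⟨hU, hB, hc, fun U' h1 h2 h3 => huniq U' h1 h2 h3⟩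

/-! ## §4 CLAUSE (i): at most one critical configuration in 𝔘(ε₀) ∩ K_V -/

/-- **The constant a₀ of the model**: min{a₃/2, (8B₀C₄)⁻¹}/(1 + 4B₀C₁) (print: a₀ = a₄/(16B₁C₁) by (122); reading (M7-a)).
[cite: Balaban1985Variational, (122) p.296, Prop. 7 p.299] -/
def a0 (B₀ C₄ a₃ C₁ : ℝ) : ℝ :=
  min (a₃ / (2 * (1 + 4 * B₀ * C₁))) (1 / (8 * B₀ * C₄ * (1 + 4 * B₀ * C₁)))

/-- a₀ > 0 for positive constants. [cite: Balaban1985Variational, Prop. 7 p.299] -/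
theorem a0_pos (hB₀ : 0 < B₀) (hC₄ : 0 < C₄) (ha₃ : 0 < a₃) {C₁ : ℝ} (hC₁ : 0 < C₁) : 0 < a0 B₀ C₄ a₃ C₁ := by
  unfold a0
  exact lt_min (by positivity) (by positivity)

/-- The two conditions (121) for the ball of clause (i): with ε₀ ≤ a₀, `2ε₀(1 + 4B₀C₁) ≤ a₃` and `4B₀C₄ε₀(1 + 4B₀C₁) ≤ ½`.
[cite: Balaban1985Variational, (121)–(122) pp.295–296] -/
theorem conds_of_le_a0 (hB₀ : 0 < B₀) (hC₄ : 0 < C₄) {C₁ ε₀ : ℝ} (hC₁ : 0 < C₁) (hε₀ : ε₀ ≤ a0 B₀ C₄ a₃ C₁) :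
    2 * (ε₀ * (1 + 4 * B₀ * C₁)) ≤ a₃ ∧ 4 * B₀ * C₄ * (ε₀ * (1 + 4 * B₀ * C₁)) ≤ 1 / 2 := by
  have hk : 0 < 1 + 4 * B₀ * C₁ := by positivity
  have h1 : ε₀ ≤ a₃ / (2 * (1 + 4 * B₀ * C₁)) := hε₀.trans (min_le_left _ _)
  have h2 : ε₀ ≤ 1 / (8 * B₀ * C₄ * (1 + 4 * B₀ * C₁)) := hε₀.trans (min_le_right _ _)
  have h1' := (le_div_iff₀ (by positivity)).1 h1
  have h2' := (le_div_iff₀ (by positivity)).1 h2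
  constructor
  · linarith
  · nlinarith

/-- **Proposition 7, clause (i), in the model** (p. 296 «by Propositions 5 and 6 there is at most one critical configuration … (122) thus if
B₃ε₁ ≦ ε₀ and 16B₁C₁ε₀ ≦ a₄, then the functional (5) has at most one critical orbit in the space (6)»).  With (103) ‖H₁b‖ < 2dLB₀C₁ε₁
((28) is not needed for this clause), dL ≤ B₃, B₃ε₁ ≤ ε₀ ≤ a₀: two (82)-critical configurations A′, A″ ∈ 𝔘(ε₀) ∩ K_V are equal.  PROOF AS PRINTED: by
Prop. 5 (`crit_iff_fixed`) A′ − H₁b and A″ − H₁b are fixed points of (116) in the ball ‖A₁‖ ≤ ε₀ + 2dLB₀C₁ε₁ ((115) with ε₄ = ε₀ + B₀|B|-type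
radius), on which (116) is a strict contraction by (120)–(121) (`eq_of_fixed`), «B₃ε₁ ≦ ε₀» bounding 2dLB₀C₁ε₁ ≤ 2B₀C₁ε₀ as in (122).
[cite: Balaban1985Variational, Prop. 7 p.299, p.296 (122), Props. 5–6 pp.294–295] -/
theorem eq_of_crit (hB₀ : 0 < B₀) (hC₄ : 0 < C₄) {C₁ ε₀ ε₁ : ℝ} (hC₁ : 0 < C₁) (hε₁ : 0 < ε₁)
    (V : Bdry) (hH : ‖(Dt.ops V).H₁ (Dt.bdat V)‖ < 2 * ((Dt.dim : ℝ) * Dt.L) * B₀ * C₁ * ε₁)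
    (hB₃ε : B₃ * ε₁ ≤ ε₀) (hε₀ : ε₀ ≤ a0 B₀ C₄ a₃ C₁)
    {A A' : E} (hA : ‖A‖ < ε₀) (hAK : A ∈ Dt.Kset V) (hcA : Dt.Crit V A)
    (hA' : ‖A'‖ < ε₀) (hAK' : A' ∈ Dt.Kset V) (hcA' : Dt.Crit V A') : A = A' := by
  -- the radius 2dLB₀C₁ε₁ of (103) is ≤ 2B₀C₁B₃ε₁ ≤ 2B₀C₁ε₀ («B₃ε₁ ≦ ε₀», as in (122))
  have hdL : 0 ≤ (Dt.dim : ℝ) * Dt.L := mul_nonneg (Nat.cast_nonneg _) Dt.L_nonneg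
  have ha1 : 2 * ((Dt.dim : ℝ) * Dt.L) * B₀ * C₁ * ε₁ ≤ 2 * B₀ * C₁ * B₃ * ε₁ := by
    have := mul_le_mul_of_nonneg_left Dt.dL_le (by positivity : (0 : ℝ) ≤ 2 * B₀ * C₁ * ε₁)
    linarith
  have ha2 : 2 * B₀ * C₁ * B₃ * ε₁ ≤ 2 * B₀ * C₁ * ε₀ := by
    have := mul_le_mul_of_nonneg_left hB₃ε (by positivity : (0 : ℝ) ≤ 2 * B₀ * C₁)
    linarith
  obtain ⟨hd, hc⟩ := conds_of_le_a0 hB₀ hC₄ hC₁ hε₀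
  -- the ball (115) of radius ε₀ + 2dLB₀C₁ε₁ contains both translates; (121) holds on it
  have hdom : 2 * ((ε₀ + 2 * ((Dt.dim : ℝ) * Dt.L) * B₀ * C₁ * ε₁) + 2 * ((Dt.dim : ℝ) * Dt.L) * B₀ * C₁ * ε₁) ≤ a₃ := by
    linarith
  have hcontr : 4 * B₀ * C₄ * ((ε₀ + 2 * ((Dt.dim : ℝ) * Dt.L) * B₀ * C₁ * ε₁) +
      2 * ((Dt.dim : ℝ) * Dt.L) * B₀ * C₁ * ε₁) < 1 := by
    have h4 : 4 * B₀ * C₄ * ((ε₀ + 2 * ((Dt.dim : ℝ) * Dt.L) * B₀ * C₁ * ε₁) +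
        2 * ((Dt.dim : ℝ) * Dt.L) * B₀ * C₁ * ε₁) ≤ 4 * B₀ * C₄ * (ε₀ * (1 + 4 * B₀ * C₁)) :=
      mul_le_mul_of_nonneg_left (by linarith) (by positivity)
    linarith
  have h₁ : ‖A - (Dt.ops V).H₁ (Dt.bdat V)‖ ≤ ε₀ + 2 * ((Dt.dim : ℝ) * Dt.L) * B₀ * C₁ * ε₁ :=
    (norm_sub_le _ _).trans (by linarith [hA.le, hH.le])
  have h₂ : ‖A' - (Dt.ops V).H₁ (Dt.bdat V)‖ ≤ ε₀ + 2 * ((Dt.dim : ℝ) * Dt.L) * B₀ * C₁ * ε₁ :=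
    (norm_sub_le _ _).trans (by linarith [hA'.le, hH.le])
  -- Prop. 5: both translates are fixed points of (116); Prop. 6: uniqueness by (120)–(121)
  have hf₁ := (Dt.crit_iff_fixed V hAK).1 hcA
  have hf₂ := (Dt.crit_iff_fixed V hAK').1 hcA'
  have hfix := eq_of_fixed (J := (Dt.ops V).J) (Dt.norm_G V) hB₀.le (Dt.lip120 V) hH hdom hcontr h₁ h₂ hf₁ hf₂
  exact sub_left_injective hfix

/-- Clause (i) in the typed vocabulary: `(Dt.toVarProblemX C₁).AtMostOneCriticalOrbit ε₀ V` for V with (7) (read (28) ∧ (103)), B₃ε₁ ≤ ε₀ ≤ a₀.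
[cite: Balaban1985Variational, Prop. 7 p.299] -/
theorem atMostOne_model (hB₀ : 0 < B₀) (hC₄ : 0 < C₄) {C₁ ε₀ ε₁ : ℝ} (hC₁ : 0 < C₁) (hε₁ : 0 < ε₁) (V : Bdry)
    (hV : (Dt.toVarProblemX C₁).Reg7 ε₁ V) (hε₀ : ε₀ ≤ a0 B₀ C₄ a₃ C₁) (hB₃ε : B₃ * ε₁ ≤ ε₀) :
    (Dt.toVarProblemX C₁).AtMostOneCriticalOrbit ε₀ V := by
  dsimp only [B11.VarProblemX.AtMostOneCriticalOrbit, toVarProblemX] at hV ⊢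
  intro U U' hU hBU hcU hU' hBU' hcU'
  exact Dt.eq_of_crit hB₀ hC₄ hC₁ hε₁ V hV.2 hB₃ε hε₀ hU hBU hcU hU' hBU' hcU'

/-! ## §5 CLAUSE (ii): existence of the critical configuration and its minimality -/

/-- **The constant a₄′ of the model**: min{a₃/4, (16B₀C₄)⁻¹, γ/(32C₄)} — Prop. 6's a₄ = min{a₃/4, (16B₀C₄)⁻¹} (`B11Prop6Scheme.le_a4_iff`) and
one more member for the minimality step (gap γ ≥ 2θ, θ the (120)-Lipschitz constant on the ball of radius 2ε₄).
[cite: Balaban1985Variational, Prop. 6 p.295, (142) p.299] -/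
def a4' (B₀ C₄ a₃ γ : ℝ) : ℝ :=
  min (a₃ / 4) (min (1 / (16 * B₀ * C₄)) (γ / (32 * C₄)))

/-- **The constant a′₁ of the model**: a₄′/(2B₀C₁B₃) («Equation (111) has a solution belonging to the space (115) with ε₄ = 2B₀C₁B₃ε₁, if
2B₀C₁B₃ε₁ ≦ a₄», p. 296). [cite: Balaban1985Variational, p.296 after (122), Prop. 7 p.299] -/
def a1' (B₀ C₄ a₃ γ B₃ C₁ : ℝ) : ℝ :=
  a4' B₀ C₄ a₃ γ / (2 * B₀ * C₁ * B₃)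

/-- a′₁ > 0 for positive constants. [cite: Balaban1985Variational, Prop. 7 p.299] -/
theorem a1'_pos (hB₀ : 0 < B₀) (hC₄ : 0 < C₄) (ha₃ : 0 < a₃) (hγ : 0 < γ) (hB₃ : 0 < B₃) {C₁ : ℝ} (hC₁ : 0 < C₁) :
    0 < a1' B₀ C₄ a₃ γ B₃ C₁ := by
  unfold a1' a4'
  exact div_pos (lt_min (by positivity) (lt_min (by positivity) (by positivity))) (by positivity)

/-- **(118) and (121) at ε₄ = 2B₀C₁B₃ε₁** (p. 295 «These conditions are satisfied if e.g. 2B₀C₁B₃ε₁ ≦ ε₄ and ε₄ ≦ a₄»), plus the gap condition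
of the minimality step: for ρ = 2B₀C₁B₃ε₁ ≤ a₄′, j = C₁B₃ε₁ and any a ≤ ρ: 2(ρ + a) ≤ a₃, B₀j + B₀C₄(ρ + a)² ≤ ρ, 4B₀C₄(ρ + a) ≤ ½,
2(2ρ) ≤ a₃ and 2·(4C₄(2ρ)) < γ. [cite: Balaban1985Variational, (118), (121) p.295] -/
theorem conds_118_121 (hB₀ : 0 < B₀) (hC₄ : 0 < C₄) (hγ : 0 < γ) {C₁ B₃' ε₁ a : ℝ} (hC₁ : 0 < C₁) (hB₃ : 0 < B₃')
    (hε₁ : 0 < ε₁) (hρ : 2 * B₀ * C₁ * B₃' * ε₁ ≤ a4' B₀ C₄ a₃ γ) (ha0 : 0 ≤ a) (ha : a ≤ 2 * B₀ * C₁ * B₃' * ε₁) :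
    2 * (2 * B₀ * C₁ * B₃' * ε₁ + a) ≤ a₃ ∧
      B₀ * (C₁ * B₃' * ε₁) + B₀ * C₄ * (2 * B₀ * C₁ * B₃' * ε₁ + a) ^ 2 ≤ 2 * B₀ * C₁ * B₃' * ε₁ ∧
      4 * B₀ * C₄ * (2 * B₀ * C₁ * B₃' * ε₁ + a) ≤ 1 / 2 ∧
      2 * (2 * (2 * B₀ * C₁ * B₃' * ε₁)) ≤ a₃ ∧ 2 * (4 * C₄ * (2 * (2 * B₀ * C₁ * B₃' * ε₁))) < γ := by
  set ρ := 2 * B₀ * C₁ * B₃' * ε₁ with hρdef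
  have hρpos : 0 < ρ := by positivity
  have h1 : ρ ≤ a₃ / 4 := hρ.trans (min_le_left _ _)
  have h2 : ρ ≤ 1 / (16 * B₀ * C₄) := hρ.trans ((min_le_right _ _).trans (min_le_left _ _))
  have h3 : ρ ≤ γ / (32 * C₄) := hρ.trans ((min_le_right _ _).trans (min_le_right _ _))
  have h1' := (le_div_iff₀ (by positivity)).1 h1
  have h2' := (le_div_iff₀ (by positivity)).1 h2
  have h3' := (le_div_iff₀ (by positivity)).1 h3
  have hsq : (ρ + a) ^ 2 ≤ 4 * ρ ^ 2 := by nlinarith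
  refine ⟨by linarith, ?_, by nlinarith, by linarith, by linarith⟩
  have e1 : B₀ * (C₁ * B₃' * ε₁) = ρ / 2 := by rw [hρdef]; ring
  have e2 : B₀ * C₄ * (ρ + a) ^ 2 ≤ B₀ * C₄ * (4 * ρ ^ 2) := mul_le_mul_of_nonneg_left hsq (by positivity)
  have e3 : B₀ * C₄ * (4 * ρ ^ 2) ≤ ρ / 4 := by nlinarith
  linarith

/-- The Lipschitz hypothesis of `B11Eq142LocalMin.isMinOn_of_critical` from (120): on the ball ‖A′‖ < m (2m ≤ a₃) the derivative
A′ ↦ ⟨·, W(A′)⟩ is 4C₄m-Lipschitz in operator norm. [cite: Balaban1985Variational, (120) p.295] -/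
theorem norm_innerSL_gradV_sub_le (V : Bdry) {m : ℝ} (hm : 2 * m ≤ a₃) {x A : E} (hx : ‖x‖ < m) (hA : ‖A‖ < m) :
    ‖innerSL ℝ ((Dt.ops V).gradV x) - innerSL ℝ ((Dt.ops V).gradV A)‖ ≤ 4 * C₄ * m * ‖x - A‖ := by
  rw [← map_sub, innerSL_apply_norm]
  exact Dt.lip120 V m hm x A hx hA

/-- **Proposition 7, clause (ii), in the model — the critical configuration and its minimality.**  With (28) ‖J‖ ≤ C₁B₃ε₁, (103) ‖H₁b‖ <
2dLB₀C₁ε₁, dL ≤ B₃ and 0 < ε₁ ≤ a′₁: there is A⋆ ∈ K_V with ‖A⋆‖ < 4B₀C₁B₃ε₁ which is (82)-critical and is THE STRICT GLOBAL MINIMUM of 𝔉_V on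
the space (6) ∩ K_V with ε₀ = 4B₀C₁B₃ε₁.  PROOF AS PRINTED: p. 296 — the fixed point A₁ of (116) in ‖A₁‖ ≤ ε₄ = 2B₀C₁B₃ε₁ exists by (118), (121)
(`existsUnique_fixed`, `conds_118_121`); (112) A⋆ := A₁ + H₁b is critical by Prop. 5 (`crit_iff_fixed`; A⋆ ∈ K_V by «Q𝔊 = 0, RD*𝔊 = 0», QH₁b = b,
RD*H₁ = 0); p. 299 (141)–(142) — minimum from criticality + «positive definite» (`B11Eq142LocalMin.isMinOn_of_critical` / `lt_of_critical_of_ne`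
with gap γ > 2θ, θ = 4C₄·(4B₀C₁B₃ε₁)). [cite: Balaban1985Variational, Prop. 7 p.299, p.296 after (122), (112) p.294, (141)–(142) p.299] -/
theorem exists_critical_minOn [CompleteSpace E] (hB₀ : 0 < B₀) (hC₄ : 0 < C₄) (hγ : 0 < γ) (hB₃ : 0 < B₃) {C₁ ε₁ : ℝ}
    (hC₁ : 0 < C₁) (hε₁ : 0 < ε₁) (V : Bdry) (hJ : ‖(Dt.ops V).J‖ ≤ C₁ * B₃ * ε₁)
    (hH : ‖(Dt.ops V).H₁ (Dt.bdat V)‖ < 2 * ((Dt.dim : ℝ) * Dt.L) * B₀ * C₁ * ε₁) (hε₁a : ε₁ ≤ a1' B₀ C₄ a₃ γ B₃ C₁) :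
    ∃ Astar : E, ‖Astar‖ < 4 * B₀ * C₁ * B₃ * ε₁ ∧ Astar ∈ Dt.Kset V ∧ Dt.Crit V Astar ∧
      IsMinOn (Dt.frakF V) (Dt.Kset V ∩ ball 0 (4 * B₀ * C₁ * B₃ * ε₁)) Astar ∧
      ∀ A ∈ Dt.Kset V ∩ ball 0 (4 * B₀ * C₁ * B₃ * ε₁), A ≠ Astar → Dt.frakF V Astar < Dt.frakF V A := by
  have hX := Dt.hyps V
  have hdL : 0 ≤ (Dt.dim : ℝ) * Dt.L := mul_nonneg (Nat.cast_nonneg _) Dt.L_nonneg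
  have ha0 : 0 ≤ 2 * ((Dt.dim : ℝ) * Dt.L) * B₀ * C₁ * ε₁ := by positivity
  have haρ : 2 * ((Dt.dim : ℝ) * Dt.L) * B₀ * C₁ * ε₁ ≤ 2 * B₀ * C₁ * B₃ * ε₁ := by
    have := mul_le_mul_of_nonneg_left Dt.dL_le (by positivity : (0 : ℝ) ≤ 2 * B₀ * C₁ * ε₁)
    linarith
  have hρa4 : 2 * B₀ * C₁ * B₃ * ε₁ ≤ a4' B₀ C₄ a₃ γ := by
    have h := (le_div_iff₀ (by positivity : (0 : ℝ) < 2 * B₀ * C₁ * B₃)).1 hε₁a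
    linarith
  obtain ⟨hdom, hself, hcontr, hdom2, hgap⟩ := conds_118_121 hB₀ hC₄ hγ hC₁ hB₃ hε₁ hρa4 ha0 haρ
  -- p. 296: the fixed point of (116) in the ball ‖A₁‖ ≤ ε₄ = 2B₀C₁B₃ε₁ ((118), (121))
  obtain ⟨A₁, ⟨hA₁, hfix⟩, -⟩ := existsUnique_fixed (J := (Dt.ops V).J) (Dt.norm_G V) hB₀.le hC₄.le
    (Dt.quad98 V) (Dt.lip120 V) hJ hH (by positivity) hdom hself (by linarith)
  -- (112): A⋆ = A₁ + H₁b lies in K_V («Q𝔊 = 0, RD*𝔊 = 0», QH₁b = b, RD*H₁b = 0), in 𝔘(4B₀C₁B₃ε₁), and is critical (Prop. 5)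
  have hA₁T : A₁ ∈ Dt.T83 V := by
    have := Dt.T116_mem_T83 V A₁
    rwa [show Dt.T116 V A₁ = A₁ from hfix] at this
  obtain ⟨hQ₁, hR₁⟩ := (mem_tangent83_iff _ _ _ A₁).1 hA₁T
  have hAK : A₁ + (Dt.ops V).H₁ (Dt.bdat V) ∈ Dt.Kset V := by
    refine ⟨?_, ?_⟩
    · rw [map_add, hQ₁, zero_add]
      exact B11Eq129Minimizer.constraint_hOp hX.Kinv_spec _
    · rw [map_add, map_add, hR₁, zero_add]
      exact hX.landau _
  have hnorm : ‖A₁ + (Dt.ops V).H₁ (Dt.bdat V)‖ < 4 * B₀ * C₁ * B₃ * ε₁ := by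
    calc ‖A₁ + (Dt.ops V).H₁ (Dt.bdat V)‖ ≤ ‖A₁‖ + ‖(Dt.ops V).H₁ (Dt.bdat V)‖ := norm_add_le _ _
      _ < 2 * B₀ * C₁ * B₃ * ε₁ + 2 * ((Dt.dim : ℝ) * Dt.L) * B₀ * C₁ * ε₁ := add_lt_add_of_le_of_lt hA₁ hH
      _ ≤ 4 * B₀ * C₁ * B₃ * ε₁ := by linarith
  have hcrit : Dt.Crit V (A₁ + (Dt.ops V).H₁ (Dt.bdat V)) := by
    rw [Dt.crit_iff_fixed V hAK, add_sub_cancel_right]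
    exact hfix
  -- p. 299 (141)–(142): minimum on the space (6) with ε₀ = 4B₀C₁B₃ε₁ from criticality + «positive definite»
  have hS : Convex ℝ (ball (0 : E) (4 * B₀ * C₁ * B₃ * ε₁)) := convex_ball _ _
  have hKS : Dt.Kset V ∩ ball 0 (4 * B₀ * C₁ * B₃ * ε₁) ⊆ ball 0 (4 * B₀ * C₁ * B₃ * ε₁) := inter_subset_right
  have hVd : ∀ x ∈ ball (0 : E) (4 * B₀ * C₁ * B₃ * ε₁), HasFDerivWithinAt (Dt.Vfun V)
      ((fun y => innerSL ℝ ((Dt.ops V).gradV y)) x) (ball 0 (4 * B₀ * C₁ * B₃ * ε₁)) x :=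
    fun x _ => (Dt.hasGrad V x).hasFDerivWithinAt
  have hθ : (0 : ℝ) ≤ 4 * C₄ * (4 * B₀ * C₁ * B₃ * ε₁) := by positivity
  have hγθ : 2 * (4 * C₄ * (4 * B₀ * C₁ * B₃ * ε₁)) < γ := by linarith
  have hAKb : A₁ + (Dt.ops V).H₁ (Dt.bdat V) ∈ Dt.Kset V ∩ ball 0 (4 * B₀ * C₁ * B₃ * ε₁) :=
    ⟨hAK, mem_ball_zero_iff.2 hnorm⟩
  have hdome : 2 * (4 * B₀ * C₁ * B₃ * ε₁) ≤ a₃ := by linarith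
  have hLip : ∀ x ∈ ball (0 : E) (4 * B₀ * C₁ * B₃ * ε₁),
      ‖(fun y => innerSL ℝ ((Dt.ops V).gradV y)) x -
          (fun y => innerSL ℝ ((Dt.ops V).gradV y)) (A₁ + (Dt.ops V).H₁ (Dt.bdat V))‖ ≤
        4 * C₄ * (4 * B₀ * C₁ * B₃ * ε₁) * ‖x - (A₁ + (Dt.ops V).H₁ (Dt.bdat V))‖ :=
    fun x hx => Dt.norm_innerSL_gradV_sub_le V hdome (mem_ball_zero_iff.1 hx) hnorm
  have hKT : ∀ A ∈ Dt.Kset V ∩ ball 0 (4 * B₀ * C₁ * B₃ * ε₁),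
      A - (A₁ + (Dt.ops V).H₁ (Dt.bdat V)) ∈ Dt.T83 V :=
    fun A hA => Dt.sub_mem_T83 V hA.1 hAK
  have hmin : IsMinOn (Dt.frakF V) (Dt.Kset V ∩ ball 0 (4 * B₀ * C₁ * B₃ * ε₁)) (A₁ + (Dt.ops V).H₁ (Dt.bdat V)) :=
    isMinOn_of_critical (Dt.act0 V) (Dt.ops V).J (Dt.symm V) hS hKS hVd hθ hγθ.le (Dt.coercive V) hAKb hLip hKT hcrit
  refine ⟨A₁ + (Dt.ops V).H₁ (Dt.bdat V), hnorm, hAK, hcrit, hmin, fun A hA hne => ?_⟩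
  exact lt_of_critical_of_ne (Dt.act0 V) (Dt.ops V).J (Dt.symm V) hS hKS hVd hθ hγθ (Dt.coercive V) hAKb hLip hKT
    hcrit hA hne

omit [InnerProductSpace ℝ E] in
/-- A global minimum on K_V ∩ 𝔘(e) at an interior point is a local minimum on K_V (𝔘(e) is open): the typed (local) reading of «minimal orbit»
follows from the global statement of `exists_critical_minOn`. [cite: Balaban1985Variational, (142) p.299] -/
theorem isLocalMinOn_of_isMinOn_inter_ball {f : E → ℝ} {K : Set E} {e : ℝ} {A : E} (hA : ‖A‖ < e)
    (hmin : IsMinOn f (K ∩ ball 0 e) A) : IsLocalMinOn f K A := by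
  have hB : ball (0 : E) e ∈ 𝓝[K] A := mem_nhdsWithin_of_mem_nhds (isOpen_ball.mem_nhds (mem_ball_zero_iff.2 hA))
  have hK : K ∈ 𝓝[K] A := self_mem_nhdsWithin
  show ∀ᶠ x in 𝓝[K] A, f A ≤ f x
  filter_upwards [hB, hK] with x hxB hxK
  exact hmin ⟨hxK, hxB⟩

/-- Clause (ii) in the typed vocabulary: for V with (7) (read (28) ∧ (103)) and 0 < ε₁ ≤ a′₁ there is a configuration on a minimal orbit in
the space (6) with ε₀ = 4B₀C₁B₃ε₁ (O(1) = 4B₀). [cite: Balaban1985Variational, Prop. 7 p.299] -/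
theorem existsMinimal_model [CompleteSpace E] (hB₀ : 0 < B₀) (hC₄ : 0 < C₄) (hγ : 0 < γ) (hB₃ : 0 < B₃) {C₁ ε₁ : ℝ}
    (hC₁ : 0 < C₁) (hε₁ : 0 < ε₁) (V : Bdry) (hV : (Dt.toVarProblemX C₁).Reg7 ε₁ V)
    (hε₁a : ε₁ ≤ a1' B₀ C₄ a₃ γ B₃ C₁) :
    ∃ U : E, (Dt.toVarProblemX C₁).OnMinimalOrbit (4 * B₀ * C₁ * B₃ * ε₁) V U := by
  dsimp only [toVarProblemX] at hV ⊢
  obtain ⟨Astar, hnorm, hAK, -, hmin, -⟩ := Dt.exists_critical_minOn hB₀ hC₄ hγ hB₃ hC₁ hε₁ V hV.1 hV.2 hε₁a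
  exact ⟨Astar, hnorm, hAK, isLocalMinOn_of_isMinOn_inter_ball hnorm hmin⟩

/-- The two clauses give «the orbit of A⋆ is the unique critical orbit» in 𝔘(ε₀) for 4B₀C₁B₃ε₁ ≤ ε₀ ≤ a₀ and B₃ε₁ ≤ ε₀ — the shape Theorem 1
quotes («This orbit is a unique critical orbit in the space (6) if B₃ε₁ ≦ ε₀ and ε₀ ≦ a₀»). [cite: Balaban1985Variational, Thm 1 p.279, Prop. 7 p.299] -/
theorem uniqueCriticalOrbit_model [CompleteSpace E] (hB₀ : 0 < B₀) (hC₄ : 0 < C₄) (hγ : 0 < γ) (hB₃ : 0 < B₃) {C₁ ε₀ ε₁ : ℝ}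
    (hC₁ : 0 < C₁) (hε₁ : 0 < ε₁) (V : Bdry) (hV : (Dt.toVarProblemX C₁).Reg7 ε₁ V)
    (hε₁a : ε₁ ≤ a1' B₀ C₄ a₃ γ B₃ C₁) (he : 4 * B₀ * C₁ * B₃ * ε₁ ≤ ε₀) (hε₀ : ε₀ ≤ a0 B₀ C₄ a₃ C₁)
    (hB₃ε : B₃ * ε₁ ≤ ε₀) :
    ∃ U : E, (Dt.toVarProblemX C₁).UniqueCriticalOrbit ε₀ V U := by
  dsimp only [toVarProblemX] at hV ⊢
  obtain ⟨Astar, hnorm, hAK, hcrit, -, -⟩ := Dt.exists_critical_minOn hB₀ hC₄ hγ hB₃ hC₁ hε₁ V hV.1 hV.2 hε₁a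
  refine ⟨Astar, hnorm.trans_le he, hAK, hcrit, fun A' hA' hA'K hcA' => ?_⟩
  exact Dt.eq_of_crit hB₀ hC₄ hC₁ hε₁ V hV.2 hB₃ε hε₀ hA' hA'K hcA' (hnorm.trans_le he) hAK hcrit

end ChartDatum

/-! ## §6 Proposition 7 for the model family -/

section Family

variable {I : Type} (Ef Ff Sf Bdryf : I → Type) [∀ i, NormedAddCommGroup (Ef i)] [∀ i, InnerProductSpace ℝ (Ef i)]
  [∀ i, CompleteSpace (Ef i)] [∀ i, NormedAddCommGroup (Ff i)] [∀ i, InnerProductSpace ℝ (Ff i)]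
  [∀ i, AddCommGroup (Sf i)] [∀ i, Module ℝ (Sf i)]

/-- **Proposition 7 (p. 299) — the typed statement of record `B11.Prop7Printed B₃ C₁ fam` INHABITED for the model family** of chart data `δ i`
(carriers varying with the index, printed constants B₀, C₄, a₃, γ, B₃, C₁ > 0 fixed): with a₀ = min{a₃/2, (8B₀C₄)⁻¹}/(1 + 4B₀C₁), a′₁ =
min{a₃/4, (16B₀C₄)⁻¹, γ/(32C₄)}/(2B₀C₁B₃) and O(1) = 4B₀ chosen BEFORE the index, for every i, every 0 < ε₁, every ε₀ and every V with (7):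
(ε₀ ≤ a₀ ∧ B₃ε₁ ≤ ε₀ ⇒ at most one critical orbit in (6)) ∧ (ε₁ ≤ a′₁ ⇒ a minimal orbit in (6) with ε₀ = O(1)C₁B₃ε₁).  Proof = §4 + §5, i.e.
the printed route Prop. 5 + Prop. 6 + (141)–(142) carried out in the one-norm chart model; the analytic inputs are data of the index (NOT
proved). [cite: Balaban1985Variational, Prop. 7 p.299] -/
theorem prop7Printed_model {B₀ C₄ a₃ γ B₃ C₁ : ℝ} (hB₀ : 0 < B₀) (hC₄ : 0 < C₄) (ha₃ : 0 < a₃) (hγ : 0 < γ)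
    (hB₃ : 0 < B₃) (hC₁ : 0 < C₁) (δ : ∀ i, ChartDatum (Ef i) (Ff i) (Sf i) (Bdryf i) B₀ C₄ a₃ γ B₃) :
    B11.Prop7Printed B₃ C₁ (fun i => (δ i).toVarProblemX C₁) := by
  refine ⟨ChartDatum.a0 B₀ C₄ a₃ C₁, ChartDatum.a1' B₀ C₄ a₃ γ B₃ C₁, 4 * B₀,
    ChartDatum.a0_pos hB₀ hC₄ ha₃ hC₁, ChartDatum.a1'_pos hB₀ hC₄ ha₃ hγ hB₃ hC₁, by positivity, ?_⟩
  intro i ε₀ ε₁ hε₁ V hV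
  refine ⟨fun hε₀ hB₃ε => (δ i).atMostOne_model hB₀ hC₄ hC₁ hε₁ V hV hε₀ hB₃ε, fun hε₁a => ?_⟩
  exact (δ i).existsMinimal_model hB₀ hC₄ hγ hB₃ hC₁ hε₁ V hV hε₁a

omit [∀ i, CompleteSpace (Ef i)] in
/-- The dictionary `B11.VarProblemX.Laws` for every member of the family (so that `B11.thm1_of_prop7_prop8_sectF` applies to the family verbatim,
given the typed Proposition 8 and Sect. F statements for it — NOT claimed here). [cite: Balaban1985Variational, pp.299–305] -/
theorem laws_model {B₀ C₄ a₃ γ B₃ : ℝ} (C₁ : ℝ) (δ : ∀ i, ChartDatum (Ef i) (Ff i) (Sf i) (Bdryf i) B₀ C₄ a₃ γ B₃) :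
    ∀ i, ((δ i).toVarProblemX C₁).Laws :=
  fun i => (δ i).laws C₁

end Family

end Literature.MathematicalPhysics.QuantumFieldTheory.Balaban1983to89.B11Prop7Model

end
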